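import Mathlib
import Summits.ResolutionOfSingularities.ResolutionOfSingularities.Theorems.WeightedInvariantLocalWeightedDropNCResSettingStrict
import Summits.ResolutionOfSingularities.ResolutionOfSingularities.Theorems.WeightedInvariantLocalWeightedDropMonomialPhaseChart

/-!
# `LocalWeightedDrop`, the NC count game — TOT2-LINE piece S-SET (6): **B-PERMISSIBILITY — THE POINT CENTRE, AND THE `I₃`-DEVICE
# `f̃ = f · ∏_{l ∈ O} x_l`**

[OURS · L1 W4.3 · chain w43, engine crux `LocalWeightedDrop` stmt-ResolutionOfSingularities-8899; sub-line under the v32 registered stub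
`stub_spaceNCRankDrop`, design memo `L/res-L1-w43-lead-1/g4/TOT2-LINE.md` v1 §2 / v1.1 (B) («the I₃-device», Perlega arXiv:2011.14443 §7.1.3 /
Cossart–Jannsen–Saito (10.3)), piece S-SET = res-L1-w43-stub-1; objects of `…NCResSettingDefs` (p528587).  Nothing here is a statement of any manuscript.]

* `isBPermissible_point` — the POINT CENTRE (`w ≡ 1`) after any legal `Φ` that straightens the boundary is B-permissible ((P1) is `ord = weightedOrder_𝟙`
  by definition, (P2) is `ord Φ_l ≥ 1`);
* `order_mul_prod_X` — `ord (f · ∏_{l∈O} x_l) = ord f + |O|` (so Hauser–Perlega's `c = ord I₃`);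
* `weightedOrder_le_order_of_le_one` — for weights `≤ 1` the `w`-order never exceeds the order;
* **`isBPermissible_iff_totalO`** — for a legal move `(Φ, w)` straightening the boundary: (P1) ∧ (P2) for `f` ⇔ (P1) for the product
  `f̃ = f · ∏_{l∈O} x_l` («`C` permissible for `f̃`» ⇔ «`C` O-permissible for `f`», v1.1 (B)).
-/

set_option linter.dupNamespace false -- mandated namespace of this single-conjunct summit

noncomputable section

namespace Summit.ResolutionOfSingularities.ResolutionOfSingularities.Theorems

namespace TameFourTupleDrop

open MvPowerSeries Literature.AlgebraicGeometry.Resolution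

variable {k : Type} [Field k] {m : ℕ}

/-! ## Orders and weighted orders for weights `≤ 1` -/

/-- The order of a letter is `1`. -/
theorem order_X' {n : ℕ} (l : Fin n) : (X l : MvPowerSeries (Fin n) k).order = 1 := by
  rw [X_def, order_monomial_of_ne_zero one_ne_zero, Finsupp.degree_single, Nat.cast_one]


/-- For weights `w_l ≤ 1` the `w`-order never exceeds the order. -/
theorem weightedOrder_le_order_of_le_one {n : ℕ} {w : Fin n → ℕ} (hw : ∀ l, w l ≤ 1) (F : MvPowerSeries (Fin n) k) :
    F.weightedOrder w ≤ F.order :=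
  le_order fun d hd => coeff_eq_zero_of_lt_weightedOrder w
    (lt_of_le_of_lt (by exact_mod_cast NCTransport.weight_le_degree_of_le_one hw d) hd)

/-- A component of a legal coordinate change has order `1`. -/
theorem order_apply_eq_one_of_isCountMove {Φ : Fin (m + 1) → MvPowerSeries (Fin (m + 1)) k} {w : Fin (m + 1) → ℕ} (hmv : IsCountMove Φ w)
    (l : Fin (m + 1)) : (Φ l).order = 1 := by
  have h := NCTransport.order_subst_eq_of_isUnit_det hmv.1 hmv.2.1 (X l : MvPowerSeries (Fin (m + 1)) k)
  rwa [subst_X (hasSubst_of_constantCoeff_zero hmv.1), order_X'] at h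

/-- `ord (F · ∏_{l∈O} x_l) = ord F + |O|`. -/
theorem order_mul_prod_X {n : ℕ} (F : MvPowerSeries (Fin n) k) (O : Finset (Fin n)) :
    (F * ∏ l ∈ O, X l).order = F.order + O.card := by
  rw [order_mul, order_prod, Finset.sum_congr rfl (fun l _ => order_X' l), Finset.sum_const, nsmul_eq_mul, mul_one]

/-- Hauser–Perlega's `c` is the order of the `I₃`-product: `ord (f · ∏_{l∈O} x_l) = c` for an admissible decoration. -/
theorem Decoration.order_totalO {b : MvPowerSeries (Fin (m + 1)) k} {δ : Decoration k m} (hadm : Admissible b δ) :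
    (δ.f * ∏ l ∈ δ.O, X l).order = (δ.c : ℕ∞) := by
  have hf : δ.f ≠ 0 := hadm.2.1.ne_zero
  have hfin : δ.f.order ≠ ⊤ := by rw [ne_eq, order_eq_top_iff]; exact hf
  rw [order_mul_prod_X, Decoration.c, Decoration.o, Nat.cast_add, ENat.coe_toNat hfin]

/-! ## The point centre -/

/-- **THE POINT CENTRE IS B-PERMISSIBLE** after any legal coordinate change that straightens the boundary. -/
theorem isBPermissible_point {δ : Decoration k m} {Φ : Fin (m + 1) → MvPowerSeries (Fin (m + 1)) k}
    (hmv : IsCountMove Φ (fun _ => 1))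
    (hP3 : ∀ l ∈ δ.E, ∃ (l' : Fin (m + 1)) (u : MvPowerSeries (Fin (m + 1)) k), constantCoeff u ≠ 0 ∧ Φ l = u * X l') :
    IsBPermissible δ Φ (fun _ => 1) := by
  refine ⟨hmv, le_rfl, fun l _ => ?_, hP3⟩
  change (1 : ℕ∞) ≤ (Φ l).order
  rw [order_apply_eq_one_of_isCountMove hmv l]

/-- The identity move with the point centre is B-permissible (no straightening needed: the boundary letters are already coordinates). -/
theorem isBPermissible_point_X (δ : Decoration k m) :
    IsBPermissible δ (fun j => (X j : MvPowerSeries (Fin (m + 1)) k)) (fun _ => 1) := by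
  have hmv : IsCountMove (fun j => (X j : MvPowerSeries (Fin (m + 1)) k)) (fun _ : Fin (m + 1) => 1) := by
    exact ⟨fun i => constantCoeff_X i, TupleMonomialPhase.isUnit_det_X, fun _ => le_rfl, ⟨0, Nat.one_pos⟩⟩
  exact isBPermissible_point hmv fun l _ => ⟨l, 1, by rw [map_one]; exact one_ne_zero, by rw [one_mul]⟩

/-! ## The `I₃`-device: permissibility of the product `f̃ = f · ∏_{l∈O} x_l` -/

/-- **(P1) ∧ (P2) FOR `f` ⇔ (P1) FOR `f̃ = f · ∏_{l ∈ O} x_l`** (v1.1 (B): «`C` permissible for `f̃`» ⇔ «`C` O-permissible for `f`»), for a legal move;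
the orders and `w`-orders of the factors add up (`k⟦x⟧` is a domain) and each factor's `w`-order is at most its order. -/
theorem isBPermissible_iff_totalO {δ : Decoration k m} {Φ : Fin (m + 1) → MvPowerSeries (Fin (m + 1)) k} {w : Fin (m + 1) → ℕ}
    (hmv : IsCountMove Φ w) (hf : δ.f ≠ 0)
    (hP3 : ∀ l ∈ δ.E, ∃ (l' : Fin (m + 1)) (u : MvPowerSeries (Fin (m + 1)) k), constantCoeff u ≠ 0 ∧ Φ l = u * X l') :
    IsBPermissible δ Φ w ↔
      (subst Φ (δ.f * ∏ l ∈ δ.O, X l)).order ≤ (subst Φ (δ.f * ∏ l ∈ δ.O, X l)).weightedOrder w := by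
  have hΦs : HasSubst Φ := hasSubst_of_constantCoeff_zero hmv.1
  have hw := hmv.2.2.1
  have hprod : subst Φ (δ.f * ∏ l ∈ δ.O, X l) = subst Φ δ.f * ∏ l ∈ δ.O, Φ l := by
    rw [← coe_substAlgHom hΦs, map_mul, map_prod]
    simp only [coe_substAlgHom, subst_X hΦs]
  have hF0 : subst Φ δ.f ≠ 0 := FormalCoordChange.subst_ne_zero_of_isUnit_det hmv.1 hmv.2.1 hf
  have hfin : (subst Φ δ.f).order ≠ ⊤ := by rw [ne_eq, order_eq_top_iff]; exact hF0
  have hfinw : (subst Φ δ.f).weightedOrder w ≠ ⊤ :=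
    ne_top_of_le_ne_top hfin (weightedOrder_le_order_of_le_one hw _)
  have hord1 : ∀ l, (Φ l).order = 1 := order_apply_eq_one_of_isCountMove hmv
  have hwle : ∀ l, (Φ l).weightedOrder w ≤ 1 := fun l => (weightedOrder_le_order_of_le_one hw _).trans (hord1 l).le
  rw [hprod, order_mul, order_prod, weightedOrder_mul, weightedOrder_prod, Finset.sum_congr rfl (fun l _ => hord1 l)]
  constructor
  · rintro ⟨-, hP1, hP2, -⟩
    refine add_le_add hP1 (Finset.sum_le_sum fun l hl => hP2 l hl)
  · intro h
    -- cancel: each summand on the right is at most the corresponding one on the left, so all are equal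
    have hA : (subst Φ δ.f).weightedOrder w ≤ (subst Φ δ.f).order := weightedOrder_le_order_of_le_one hw _
    have hB : ∑ l ∈ δ.O, (Φ l).weightedOrder w ≤ ∑ l ∈ δ.O, (1 : ℕ∞) := Finset.sum_le_sum fun l _ => hwle l
    have hS1 : ∑ l ∈ δ.O, (1 : ℕ∞) ≠ ⊤ := by rw [Finset.sum_const, nsmul_eq_mul, mul_one]; exact ENat.coe_ne_top _
    have hSW : ∑ l ∈ δ.O, (Φ l).weightedOrder w ≠ ⊤ := ne_top_of_le_ne_top hS1 hB
    have h1 : (subst Φ δ.f).order + ∑ l ∈ δ.O, (1 : ℕ∞) ≤ (subst Φ δ.f).order + ∑ l ∈ δ.O, (Φ l).weightedOrder w :=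
      h.trans (add_le_add hA le_rfl)
    have hSeq : ∑ l ∈ δ.O, (Φ l).weightedOrder w = ∑ l ∈ δ.O, (1 : ℕ∞) :=
      le_antisymm hB ((ENat.add_le_add_iff_left hfin).mp h1)
    have hP1 : (subst Φ δ.f).order ≤ (subst Φ δ.f).weightedOrder w := by
      rw [hSeq] at h
      exact (ENat.add_le_add_iff_right hS1).mp h
    have hP2 : ∀ l ∈ δ.O, (1 : ℕ∞) ≤ (Φ l).weightedOrder w := by
      intro l₀ hl₀
      by_contra hlt
      push Not at hlt
      have hrest : ∑ l ∈ δ.O.erase l₀, (Φ l).weightedOrder w ≤ ∑ l ∈ δ.O.erase l₀, (1 : ℕ∞) := Finset.sum_le_sum fun l _ => hwle l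
      have hrestfin : ∑ l ∈ δ.O.erase l₀, (1 : ℕ∞) ≠ ⊤ := by
        rw [Finset.sum_const, nsmul_eq_mul, mul_one]; exact ENat.coe_ne_top _
      have hlt' : ∑ l ∈ δ.O, (Φ l).weightedOrder w < ∑ l ∈ δ.O, (1 : ℕ∞) := by
        rw [← Finset.add_sum_erase _ _ hl₀, ← Finset.add_sum_erase _ (fun _ => (1 : ℕ∞)) hl₀]
        calc (Φ l₀).weightedOrder w + ∑ l ∈ δ.O.erase l₀, (Φ l).weightedOrder w
            ≤ (Φ l₀).weightedOrder w + ∑ l ∈ δ.O.erase l₀, (1 : ℕ∞) := add_le_add le_rfl hrest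
          _ < 1 + ∑ l ∈ δ.O.erase l₀, (1 : ℕ∞) := (ENat.add_lt_add_iff_right hrestfin).mpr hlt
      exact absurd hSeq (ne_of_lt hlt')
    exact ⟨hmv, hP1, hP2, hP3⟩


end TameFourTupleDrop

end Summit.ResolutionOfSingularities.ResolutionOfSingularities.Theorems

end
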